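import Mathlib.NumberTheory.NumberField.Units.DirichletTheorem
import Mathlib.NumberTheory.NumberField.InfinitePlace.Ramification
import Mathlib.FieldTheory.IntermediateField.Algebraic
import HarnessLib

/-!
# Serre's congruence subgroup property for `SL₂(𝓞_F)` — proofs, VIII: powers of units span the field

Topic `Literature/NumberTheory/Automorphic`; namespace `Literature.NumberTheory.Automorphic`
(sub-namespace `SerreSL2`).  Everything here is PROVED; no definitions, no named facts.

The one analytic input of **Vaserstein 1972, Lemma 4, Case 2** (`g E(I, I) g⁻¹ ⊇ E(I'', I'')` for
`g = (1 1; 0 1)`): the additive group `X = {x : (1 0; x 1) ∈ g E(I, I) g⁻¹}` is stable under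
multiplication by `u²` and `u⁻²` for the units `u ≡ 1 (mod I²)` and contains a non-zero element;
Vaserstein concludes that `X` contains a non-zero ideal because "`K` is a finite `K'`-module,
`K' = ℤ[u², u⁻²]`, and `k` is finite-dimensional over the field of fractions `k'` of `K'`" together
with a density argument.  We isolate the arithmetic fact in the following form, for a number field
`K` **with a real place** (true for the totally real fields of Serre's theorem; false for `ℚ(i)`):

* `SerreSL2.adjoin_units_pow_eq_top` — for every `m ≥ 1`, **the `m`-th powers of the units of `𝓞 K`
  generate `K` over `ℚ`**: otherwise two distinct infinite places `w₁ ≠ w₂` of `K` agree on the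
  subfield they generate (a count of places, `exists_ne_comap_eq`), contradicting
  `|u|_{w₂} < 1 < |u|_{w₁}` for the unit `u` attached to `w₁` by Mathlib's proof of Dirichlet's unit
  theorem (`NumberField.Units.dirichletUnitTheorem.exists_unit`);
* `SerreSL2.exists_mul_mem_adjoin_of_adjoin_eq_top` — if `S ⊆ 𝓞 K` generates `K` over `ℚ` then
  **`ℤ[S]` has finite index in `𝓞 K`**: `N · 𝓞 K ⊆ ℤ[S]` for some integer `N ≥ 1`;
* `SerreSL2.exists_span_singleton_le_of_units_pow_mul_mem` — hence an additive subgroup `X ≤ 𝓞 K`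
  stable under multiplication by the `m`-th powers of all units and containing `x₀ ≠ 0` contains the
  non-zero ideal `(N x₀)`.

## References

* [Vaserstein1972SL2] L. N. Vaserstein, Mat. Sb. 89 (131) (1972) 313–322, proof of Lemma 4, Case 2
  (p. 318).
* [Liehl1981SL2Orders] B. Liehl, J. reine angew. Math. 323 (1981) 153–171, end of §3.
-/

open NumberField InfinitePlace Module

namespace Literature.NumberTheory.Automorphic

namespace SerreSL2

variable {K : Type*} [Field K] [NumberField K]

/-! ### Two places agreeing on a proper subfield -/

/-- For a proper subfield `L ⊊ K` of a number field `K` with a real place, two distinct infinite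
places of `K` restrict to the same place of `L` (`#places(L) ≤ [L:ℚ] ≤ [K:ℚ]/2 < #places(K)`).
[folklore] -/
theorem exists_ne_comap_eq {L : IntermediateField ℚ K} (hL : L ≠ ⊤)
    (hreal : ∃ w : InfinitePlace K, w.IsReal) :
    ∃ w₁ w₂ : InfinitePlace K, w₁ ≠ w₂ ∧
      w₁.comap (algebraMap L K) = w₂.comap (algebraMap L K) := by
  apply Fintype.exists_ne_map_eq_of_card_lt
  have h1 : Fintype.card (InfinitePlace L) ≤ finrank ℚ L := by
    rw [card_eq_nrRealPlaces_add_nrComplexPlaces]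
    have := card_add_two_mul_card_eq_rank L
    omega
  have h2 : 2 * finrank ℚ L ≤ finrank ℚ K := by
    have hdvd : finrank ℚ L ∣ finrank ℚ K := by
      have := IntermediateField.finrank_dvd_of_le_right (K := ℚ) (le_top : L ≤ ⊤)
      rwa [IntermediateField.finrank_top'] at this
    have hne : finrank ℚ L ≠ finrank ℚ K := fun h ↦
      hL (IntermediateField.eq_of_le_of_finrank_eq le_top
        (by rwa [IntermediateField.finrank_top']))
    obtain ⟨k, hk⟩ := hdvd
    have hK : 0 < finrank ℚ K := finrank_pos
    rcases k with _ | _ | k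
    · omega
    · simp at hk; exact absurd hk.symm hne
    · rw [hk]; nlinarith
  have h3 : finrank ℚ K < 2 * Fintype.card (InfinitePlace K) := by
    rw [card_eq_nrRealPlaces_add_nrComplexPlaces]
    have := card_add_two_mul_card_eq_rank K
    have hpos : 0 < nrRealPlaces K := by
      classical
      obtain ⟨w, hw⟩ := hreal
      exact Fintype.card_pos_iff.2 ⟨⟨w, hw⟩⟩
    omega
  omega

/-! ### Powers of units generate the field -/

/-- The unit attached to an infinite place `w₁` by Mathlib's proof of Dirichlet's unit theorem is
`> 1` at `w₁` as soon as there is another place (`∑_w mult(w) log |u|_w = 0`). [folklore] -/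
theorem one_lt_of_forall_ne_log_lt {w₁ w₂ : InfinitePlace K} (hne : w₂ ≠ w₁) {u : (𝓞 K)ˣ}
    (hu : ∀ w : InfinitePlace K, w ≠ w₁ → Real.log (w ((u : 𝓞 K) : K)) < 0) :
    1 < w₁ ((u : 𝓞 K) : K) := by
  classical
  have hupos : ∀ w : InfinitePlace K, 0 < w ((u : 𝓞 K) : K) := fun w ↦
    NumberField.Units.pos_at_place u w
  have hsum := NumberField.Units.sum_mult_mul_log u
  rw [← Finset.add_sum_erase _ _ (Finset.mem_univ w₁)] at hsum
  have hneg : ∑ w ∈ Finset.univ.erase w₁, (w.mult : ℝ) * Real.log (w ((u : 𝓞 K) : K)) < 0 := by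
    apply Finset.sum_neg
    · intro w hw
      exact mul_neg_of_pos_of_neg (Nat.cast_pos.2 mult_pos) (hu w (Finset.ne_of_mem_erase hw))
    · exact ⟨w₂, Finset.mem_erase.2 ⟨hne, Finset.mem_univ _⟩⟩
  have hpos : 0 < (w₁.mult : ℝ) * Real.log (w₁ ((u : 𝓞 K) : K)) := by linarith
  have hlog : 0 < Real.log (w₁ ((u : 𝓞 K) : K)) := pos_of_mul_pos_right hpos (Nat.cast_nonneg _)
  exact (Real.log_pos_iff (hupos _).le).1 hlog

/-- **The `m`-th powers of the units of `𝓞 K` generate `K` over `ℚ`** (`m ≥ 1`), for a number field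
`K` with a real place. [folklore] -/
theorem adjoin_units_pow_eq_top (hreal : ∃ w : InfinitePlace K, w.IsReal) {m : ℕ} (hm : m ≠ 0) :
    IntermediateField.adjoin ℚ {x : K | ∃ u : (𝓞 K)ˣ, x = ((u : 𝓞 K) : K) ^ m} = ⊤ := by
  by_contra hL
  obtain ⟨w₁, w₂, hne, heq⟩ := exists_ne_comap_eq hL hreal
  obtain ⟨u, hu⟩ := NumberField.Units.dirichletUnitTheorem.exists_unit K w₁
  have h2 : w₂ ((u : 𝓞 K) : K) < 1 :=
    (Real.log_neg_iff (NumberField.Units.pos_at_place u w₂)).1 (hu w₂ hne.symm)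
  have h1 : 1 < w₁ ((u : 𝓞 K) : K) := one_lt_of_forall_ne_log_lt hne.symm hu
  have hmem : ((u : 𝓞 K) : K) ^ m ∈
      IntermediateField.adjoin ℚ {x : K | ∃ u : (𝓞 K)ˣ, x = ((u : 𝓞 K) : K) ^ m} :=
    IntermediateField.subset_adjoin _ _ ⟨u, rfl⟩
  have hw : w₁ (((u : 𝓞 K) : K) ^ m) = w₂ (((u : 𝓞 K) : K) ^ m) := by
    have := congrArg (fun w : InfinitePlace _ ↦ w ⟨_, hmem⟩) heq
    simp only [comap_apply] at this
    exact this
  rw [map_pow, map_pow] at hw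
  have h1' : 1 < w₁ ((u : 𝓞 K) : K) ^ m := one_lt_pow₀ h1 hm
  have h2' : w₂ ((u : 𝓞 K) : K) ^ m < 1 := pow_lt_one₀ (apply_nonneg _ _) h2 hm
  linarith

/-! ### `ℤ[S]` has finite index when `ℚ(S) = K` -/

/-- An element of the `ℚ`-span of a set has a positive integer multiple in its `ℤ`-span. [folklore] -/
theorem exists_natCast_mul_mem_span_int {M : Set K} {x : K} (hx : x ∈ Submodule.span ℚ M) :
    ∃ N : ℕ, N ≠ 0 ∧ (N : K) * x ∈ Submodule.span ℤ M := by
  induction hx using Submodule.span_induction with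
  | mem x hx => exact ⟨1, one_ne_zero, by simpa using Submodule.subset_span hx⟩
  | zero => exact ⟨1, one_ne_zero, by simp⟩
  | add x y _ _ ihx ihy =>
    obtain ⟨N₁, h₁, hx⟩ := ihx
    obtain ⟨N₂, h₂, hy⟩ := ihy
    refine ⟨N₁ * N₂, mul_ne_zero h₁ h₂, ?_⟩
    have e : ((N₁ * N₂ : ℕ) : K) * (x + y) = (N₂ : ℤ) • ((N₁ : K) * x) + (N₁ : ℤ) • ((N₂ : K) * y) := by
      push_cast; simp only [zsmul_eq_mul]; push_cast; ring
    rw [e]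
    exact add_mem (Submodule.smul_mem _ _ hx) (Submodule.smul_mem _ _ hy)
  | smul q x _ ih =>
    obtain ⟨N, hN, hx⟩ := ih
    refine ⟨N * q.den, mul_ne_zero hN q.den_ne_zero, ?_⟩
    have e : ((N * q.den : ℕ) : K) * (q • x) = (q.num : ℤ) • ((N : K) * x) := by
      rw [Rat.smul_def, Rat.cast_def, zsmul_eq_mul]
      have hd : (q.den : K) ≠ 0 := Nat.cast_ne_zero.2 q.den_ne_zero
      field_simp
      push_cast
      ring
    rw [e]
    exact Submodule.smul_mem _ _ hx

/-- **`ℤ[S]` has finite index in `𝓞 K` when `ℚ(S) = K`**: if a set `S` of algebraic integers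
generates `K` as a field over `ℚ`, then `N · 𝓞 K ⊆ ℤ[S]` for some integer `N ≥ 1` (clear the
denominators of a `ℤ`-basis of `𝓞 K` written in the `ℚ`-span of the monomials in `S`). [folklore] -/
theorem exists_mul_mem_adjoin_of_adjoin_eq_top {S : Set (𝓞 K)}
    (hS : IntermediateField.adjoin ℚ ((algebraMap (𝓞 K) K) '' S) = ⊤) :
    ∃ N : ℕ, N ≠ 0 ∧ ∀ x : 𝓞 K, (N : 𝓞 K) * x ∈ Algebra.adjoin ℤ S := by
  classical
  -- pointwise
  have hpt : ∀ y : 𝓞 K, ∃ N : ℕ, N ≠ 0 ∧ (N : 𝓞 K) * y ∈ Algebra.adjoin ℤ S := by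
    intro y
    have hyK : (y : K) ∈ (IntermediateField.adjoin ℚ ((algebraMap (𝓞 K) K) '' S)).toSubalgebra := by
      rw [hS, IntermediateField.top_toSubalgebra]; exact Algebra.mem_top
    rw [IntermediateField.adjoin_toSubalgebra_of_isAlgebraic
      (fun x _ ↦ Algebra.IsAlgebraic.isAlgebraic x)] at hyK
    have hy' : (y : K) ∈ Submodule.span ℚ
        (Submonoid.closure ((algebraMap (𝓞 K) K) '' S) : Set K) := by
      rw [← Algebra.adjoin_eq_span]; exact hyK
    obtain ⟨N, hN, hNy⟩ := exists_natCast_mul_mem_span_int hy'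
    refine ⟨N, hN, ?_⟩
    rw [← Algebra.adjoin_eq_span, Subalgebra.mem_toSubmodule,
      show ((algebraMap (𝓞 K) K) '' S) = (algebraMap (𝓞 K) K).toIntAlgHom '' S from rfl,
      ← AlgHom.map_adjoin] at hNy
    obtain ⟨z, hz, hzy⟩ := Subalgebra.mem_map.1 hNy
    have hz' : z = (N : 𝓞 K) * y := by
      apply RingOfIntegers.coe_injective
      have : (algebraMap (𝓞 K) K) z = (N : K) * y := hzy
      rw [← RingOfIntegers.coe_eq_algebraMap] at this
      push_cast
      exact this
    rw [← hz']
    exact hz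
  -- over a `ℤ`-basis of `𝓞 K`
  let b := RingOfIntegers.basis K
  choose N hN hNb using fun i ↦ hpt (b i)
  refine ⟨∏ i, N i, Finset.prod_ne_zero_iff.2 fun i _ ↦ hN i, fun x ↦ ?_⟩
  rw [← b.sum_repr x, Finset.mul_sum]
  refine Subalgebra.sum_mem _ fun i _ ↦ ?_
  obtain ⟨k, hk⟩ : N i ∣ ∏ j, N j := Finset.dvd_prod_of_mem N (Finset.mem_univ i)
  have e : ((∏ j, N j : ℕ) : 𝓞 K) * (b.repr x i • b i) =
      ((b.repr x i * k : ℤ) : 𝓞 K) * ((N i : 𝓞 K) * b i) := by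
    rw [hk, zsmul_eq_mul]; push_cast; ring
  rw [e]
  exact Subalgebra.mul_mem _ (Subalgebra.intCast_mem _ _) (hNb i)

/-! ### Additive subgroups stable under the powers of the units -/

/-- **Vaserstein's Lemma 4, Case 2, arithmetic step**: in a number field with a real place, an
additive subgroup `X` of `𝓞 K` which is stable under multiplication by the `m`-th powers of all
units (`m ≥ 1`) and contains some `x₀ ≠ 0` contains the non-zero principal ideal `(N x₀)` for a
suitable integer `N ≥ 1`. [cite: Vaserstein1972SL2, Lemma 4 (proof of Case 2)] -/
theorem exists_span_singleton_le_of_units_pow_mul_mem (hreal : ∃ w : InfinitePlace K, w.IsReal)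
    {m : ℕ} (hm : m ≠ 0) (X : AddSubgroup (𝓞 K))
    (hX : ∀ u : (𝓞 K)ˣ, ∀ x ∈ X, ((u ^ m : (𝓞 K)ˣ) : 𝓞 K) * x ∈ X) {x₀ : 𝓞 K} (hx₀ : x₀ ∈ X) :
    ∃ N : ℕ, N ≠ 0 ∧ ∀ r : 𝓞 K, (N : 𝓞 K) * x₀ * r ∈ X := by
  -- the multipliers of `X` form a subring containing the `m`-th powers of the units
  let T : Subring (𝓞 K) :=
    { carrier := {r | ∀ x ∈ X, r * x ∈ X}
      mul_mem' := fun {a b} ha hb x hx ↦ by rw [mul_assoc]; exact ha _ (hb x hx)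
      one_mem' := fun x hx ↦ by rwa [one_mul]
      add_mem' := fun {a b} ha hb x hx ↦ by rw [add_mul]; exact X.add_mem (ha x hx) (hb x hx)
      zero_mem' := fun x _ ↦ by rw [zero_mul]; exact X.zero_mem
      neg_mem' := fun {a} ha x hx ↦ by rw [neg_mul]; exact X.neg_mem (ha x hx) }
  set S : Set (𝓞 K) := {y | ∃ u : (𝓞 K)ˣ, y = ((u ^ m : (𝓞 K)ˣ) : 𝓞 K)} with hSdef
  have hST : S ⊆ T := by
    rintro _ ⟨u, rfl⟩ x hx
    exact hX u x hx
  have hadj : Algebra.adjoin ℤ S ≤ subalgebraOfSubring T := Algebra.adjoin_le hST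
  -- `ℚ(S) = K`
  have hS : IntermediateField.adjoin ℚ ((algebraMap (𝓞 K) K) '' S) = ⊤ := by
    convert adjoin_units_pow_eq_top hreal hm using 2
    ext x
    simp only [hSdef, Set.mem_image, Set.mem_setOf_eq]
    constructor
    · rintro ⟨_, ⟨u, rfl⟩, rfl⟩
      exact ⟨u, by rw [Units.val_pow_eq_pow_val, map_pow]⟩
    · rintro ⟨u, rfl⟩
      exact ⟨_, ⟨u, rfl⟩, by rw [Units.val_pow_eq_pow_val, map_pow]⟩
  obtain ⟨N, hN, hNmem⟩ := exists_mul_mem_adjoin_of_adjoin_eq_top hS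
  refine ⟨N, hN, fun r ↦ ?_⟩
  have hr : (N : 𝓞 K) * r ∈ T := hadj (hNmem r)
  have := hr x₀ hx₀
  rw [show (N : 𝓞 K) * x₀ * r = (N : 𝓞 K) * r * x₀ by ring]
  exact this

end SerreSL2

end Literature.NumberTheory.Automorphic
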